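import Literature.NumberTheory.LFunctions.PartialEulerProductsSummation
import Mathlib.Topology.Order.LiminfLimsup
import HarnessLib

/-!
# Abel's limit theorem for Dirichlet series over `ℕ`: convergent partial sums

Topic `Literature/NumberTheory/LFunctions` (trunk T-ANT). The Abelian step in the proof of
K. Conrad's Theorem 5.3 (*Partial Euler products on the critical line*, Canad. J. Math. **57**
(2005), p. 279, where it appears in integral form as Lemma 5.2: "`h(x) → 0` implies
`s ∫₁^∞ h(x) x^{-s-1} dx → 0` as `s → 0⁺`"), in the discrete form matching
`Literature.NumberTheory.LFunctions.PartialEulerProductsSummation`: if the partial sums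
`A(N) = ∑_{n<N} aₙ` (`a₀ = 0`) converge to `ℓ`, then the Abel sum
`-∑ᵢ ((i+1)^{-u} - i^{-u}) A(i+1)` — the value of `∑ₙ aₙ n^{-u}` for `u > 0` — tends to `ℓ` as
`u → 0⁺` (`tendsto_abelSum_nhdsGT_zero`). Proof: the weights `wᵢ(u) = i^{-u} - (i+1)^{-u}`
(`i ≥ 1`) are nonnegative with `∑_{i ≥ I} wᵢ(u) = I^{-u}`, so the Abel sum minus `ℓ` is
`∑_{i ≥ 1} wᵢ(u) (A(i+1) - ℓ)`, bounded by `max |A - ℓ| · (1 - I^{-u}) + sup_{i ≥ I} |A(i+1) - ℓ|`,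
and `I^{-u} → 1` as `u → 0⁺`. No definitions are introduced. [folklore]

## References

* K. Conrad, *Partial Euler products on the critical line*, Canad. J. Math. 57 (2005) 267–297,
  Lemma 5.2 and proof of Thm. 5.3. [cite: Conrad2005PartialEuler]
-/

noncomputable section

open scoped Topology
open Filter Finset Complex Metric

namespace Literature.NumberTheory.LFunctions

namespace PartialEuler

/-- The weights: for real `u` and `i ≥ 1`, `(i+1)^{-u} - i^{-u} = -(i^{-u} - (i+1)^{-u})` with the
right side real. [folklore] -/
theorem cpow_neg_succ_sub_cpow_neg_eq_neg_ofReal (i : ℕ) (u : ℝ) :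
    ((i + 1 : ℕ) : ℂ) ^ (-(u : ℂ)) - (i : ℂ) ^ (-(u : ℂ)) =
      -((((i : ℝ) ^ (-u) - ((i + 1 : ℕ) : ℝ) ^ (-u) : ℝ)) : ℂ) := by
  rw [natCast_cpow_neg_ofReal, natCast_cpow_neg_ofReal]
  push_cast
  ring

/-- Telescoping: `∑_{i ∈ [I, N)} (i^{-u} - (i+1)^{-u}) = I^{-u} - N^{-u}`. [folklore] -/
theorem sum_Ico_rpow_neg_sub (u : ℝ) {I N : ℕ} (hIN : I ≤ N) :
    ∑ i ∈ Finset.Ico I N, ((i : ℝ) ^ (-u) - ((i + 1 : ℕ) : ℝ) ^ (-u)) =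
      (I : ℝ) ^ (-u) - (N : ℝ) ^ (-u) := by
  have := Finset.sum_Ico_eq_sum_range (fun i : ℕ => (i : ℝ) ^ (-u) - ((i + 1 : ℕ) : ℝ) ^ (-u)) I N
  rw [this]
  have htel := Finset.sum_range_sub' (fun k : ℕ => ((I + k : ℕ) : ℝ) ^ (-u)) (N - I)
  have hre : ∀ k ∈ Finset.range (N - I),
      ((I + k : ℕ) : ℝ) ^ (-u) - ((I + k + 1 : ℕ) : ℝ) ^ (-u) =
        ((I + k : ℕ) : ℝ) ^ (-u) - ((I + (k + 1) : ℕ) : ℝ) ^ (-u) := by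
    intro k _; ring_nf
  rw [Finset.sum_congr rfl hre, htel, Nat.add_zero, Nat.add_sub_cancel' hIN]

/-- The tail of the weights: `∑_{i ≥ I} (i^{-u} - (i+1)^{-u}) = I^{-u}` for `u > 0`, `I ≥ 1`
(`HasSum` form). [folklore] -/
theorem hasSum_rpow_neg_sub_tail {u : ℝ} (hu : 0 < u) {I : ℕ} (hI : I ≠ 0) :
    HasSum (fun k : ℕ => (((I + k : ℕ) : ℝ) ^ (-u) - ((I + k + 1 : ℕ) : ℝ) ^ (-u))) ((I : ℝ) ^ (-u)) := by
  rw [hasSum_iff_tendsto_nat_of_nonneg]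
  · have hsum : ∀ n : ℕ, ∑ k ∈ Finset.range n, (((I + k : ℕ) : ℝ) ^ (-u) - ((I + k + 1 : ℕ) : ℝ) ^ (-u)) =
        (I : ℝ) ^ (-u) - ((I + n : ℕ) : ℝ) ^ (-u) := by
      intro n
      have htel := Finset.sum_range_sub' (fun k : ℕ => ((I + k : ℕ) : ℝ) ^ (-u)) n
      have hre : ∀ k ∈ Finset.range n,
          ((I + k : ℕ) : ℝ) ^ (-u) - ((I + k + 1 : ℕ) : ℝ) ^ (-u) =
            ((I + k : ℕ) : ℝ) ^ (-u) - ((I + (k + 1) : ℕ) : ℝ) ^ (-u) := by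
        intro k _; ring_nf
      rw [Finset.sum_congr rfl hre, htel, Nat.add_zero]
    simp_rw [hsum]
    have h0 : Tendsto (fun n : ℕ => ((I + n : ℕ) : ℝ) ^ (-u)) atTop (𝓝 0) := by
      have h1 : Tendsto (fun n : ℕ => ((I + n : ℕ) : ℝ)) atTop atTop :=
        tendsto_natCast_atTop_atTop.comp
          (tendsto_atTop_atTop.mpr fun b => ⟨b, fun n hn => le_trans hn (Nat.le_add_left n I)⟩)
      exact (tendsto_rpow_neg_atTop hu).comp h1
    simpa using (tendsto_const_nhds (x := (I : ℝ) ^ (-u))).sub h0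
  · intro k
    have h1 : (0 : ℝ) < (I + k : ℕ) := by exact_mod_cast (by omega : 0 < I + k)
    have h2 : ((I + k : ℕ) : ℝ) ≤ ((I + k + 1 : ℕ) : ℝ) := by exact_mod_cast Nat.le_succ _
    linarith [Real.rpow_le_rpow_of_nonpos h1 h2 (neg_nonpos.mpr hu.le)]

/-- **Abel's limit theorem** (discrete form of Conrad's Lemma 5.2). Let `a : ℕ → ℂ` with `a₀ = 0`
and partial sums `A(N) = ∑_{n<N} aₙ → ℓ`. Then the Abel sum `-∑ᵢ ((i+1)^{-u} - i^{-u}) A(i+1)`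
(the value of the Dirichlet series `∑ₙ aₙ n^{-u}` for `u > 0`, see
`tendsto_sum_range_cpow_mul`) tends to `ℓ` as `u → 0⁺`.
[cite: Conrad2005PartialEuler, Lemma 5.2 and proof of Thm. 5.3] -/
theorem tendsto_abelSum_nhdsGT_zero {a : ℕ → ℂ} (ha0 : a 0 = 0) {ℓ : ℂ}
    (hA : Tendsto (fun N => ∑ n ∈ Finset.range N, a n) atTop (𝓝 ℓ)) :
    Tendsto (fun u : ℝ => -∑' i : ℕ,
      ((((i + 1 : ℕ) : ℂ) ^ (-(u : ℂ))) - (i : ℂ) ^ (-(u : ℂ))) * ∑ n ∈ Finset.range (i + 1), a n)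
      (𝓝[>] 0) (𝓝 ℓ) := by
  -- notation: `A N`, `e i = A (i+1) - ℓ`
  set A : ℕ → ℂ := fun N => ∑ n ∈ Finset.range N, a n with hAdef
  -- a global bound on `‖e‖`
  have he0 : Tendsto (fun i : ℕ => A (i + 1) - ℓ) atTop (𝓝 0) := by
    have := (hA.comp (tendsto_add_atTop_nat 1)).sub_const ℓ
    rwa [sub_self] at this
  obtain ⟨E, hE⟩ := (he0.norm).bddAbove_range
  have hEi : ∀ i, ‖A (i + 1) - ℓ‖ ≤ E := fun i => hE ⟨i, rfl⟩
  have hE0 : 0 ≤ E := (norm_nonneg _).trans (hEi 0)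
  -- a bound on `‖A‖` for the summability of the Abel series
  obtain ⟨M₀, hM₀⟩ := (hA.norm).bddAbove_range
  have hAM : ∀ N, ‖∑ n ∈ Finset.range N, a n‖ ≤ M₀ := fun N => hM₀ ⟨N, rfl⟩
  rw [Metric.tendsto_nhdsWithin_nhds]
  intro ε hε
  -- choose `I ≥ 1` with `‖e i‖ ≤ ε/3` for `i ≥ I`
  have hε3 : 0 < ε / 3 := by positivity
  obtain ⟨I₀, hI₀⟩ := Metric.tendsto_atTop.mp he0 (ε / 3) hε3
  set I : ℕ := max I₀ 1 with hIdef
  have hI1 : 1 ≤ I := le_max_right _ _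
  have hIe : ∀ i, I ≤ i → ‖A (i + 1) - ℓ‖ ≤ ε / 3 := fun i hi => by
    have := hI₀ i ((le_max_left _ _).trans hi)
    rw [dist_zero_right] at this
    exact this.le
  -- choose `δ` with `E (1 - I^{-u}) < ε/3` for `0 < u < δ`
  have hcont : Tendsto (fun u : ℝ => E * (1 - (I : ℝ) ^ (-u))) (𝓝[>] 0) (𝓝 0) := by
    have h1 : Tendsto (fun u : ℝ => (I : ℝ) ^ (-u)) (𝓝 0) (𝓝 1) := by
      have hI0 : (I : ℝ) ≠ 0 := by exact_mod_cast (by omega : I ≠ 0)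
      have hc : Continuous (fun u : ℝ => (I : ℝ) ^ (-u)) :=
        (Real.continuous_const_rpow hI0).comp continuous_neg
      have := hc.tendsto 0
      simpa using this
    have := ((tendsto_const_nhds (x := (1 : ℝ))).sub h1).const_mul E
    simp only [sub_self, mul_zero] at this
    exact this.mono_left nhdsWithin_le_nhds
  have hδ := Metric.tendsto_nhdsWithin_nhds.mp hcont (ε / 3) hε3
  obtain ⟨δ, hδ0, hδ'⟩ := hδ
  refine ⟨δ, hδ0, fun u hu hud => ?_⟩
  have hu0 : 0 < u := hu
  have hsmall : E * (1 - (I : ℝ) ^ (-u)) < ε / 3 := by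
    have := hδ' hu hud
    rw [dist_zero_right, Real.norm_eq_abs] at this
    exact lt_of_abs_lt this
  -- the Abel series and its value
  have hu' : 0 < (u : ℂ).re := by simpa using hu0
  have hsumm := summable_abelTerm hAM hu'
  set T : ℕ → ℂ := fun i => ((((i + 1 : ℕ) : ℂ) ^ (-(u : ℂ))) - (i : ℂ) ^ (-(u : ℂ))) *
    ∑ n ∈ Finset.range (i + 1), a n with hT
  -- real weights `w i = i^{-u} - (i+1)^{-u}`; for `i ≥ 1`, `T i = -w i * A(i+1)`
  set w : ℕ → ℝ := fun i => (i : ℝ) ^ (-u) - ((i + 1 : ℕ) : ℝ) ^ (-u) with hw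
  have hTw : ∀ i, T i = -(w i : ℂ) * A (i + 1) := by
    intro i
    simp only [hT, hw, hAdef]
    rw [cpow_neg_succ_sub_cpow_neg_eq_neg_ofReal]
  have hw0 : ∀ i, 1 ≤ i → 0 ≤ w i := by
    intro i hi
    have h1 : (0 : ℝ) < i := by exact_mod_cast (by omega : 0 < i)
    have h2 : (i : ℝ) ≤ ((i + 1 : ℕ) : ℝ) := by exact_mod_cast Nat.le_succ i
    simp only [hw]
    linarith [Real.rpow_le_rpow_of_nonpos h1 h2 (neg_nonpos.mpr hu0.le)]
  -- `T 0 = a 0 = 0`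
  have hT0 : T 0 = 0 := by
    simp only [hT]
    norm_num [Finset.sum_range_one, ha0]
  -- weights on `[1, I)` sum to `1 - I^{-u}`, on `[I, ∞)` to `I^{-u}`
  have hwI : ∑ i ∈ Finset.Ico 1 I, w i = 1 - (I : ℝ) ^ (-u) := by
    have := sum_Ico_rpow_neg_sub u hI1
    simp only [Nat.cast_one, Real.one_rpow] at this
    simpa only [hw] using this
  have hwtail : HasSum (fun k : ℕ => w (I + k)) ((I : ℝ) ^ (-u)) := by
    have := hasSum_rpow_neg_sub_tail hu0 (I := I) (by omega)
    refine this.congr_fun fun k => ?_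
    simp only [hw, Nat.cast_add, Nat.cast_one]
  -- decompose the tsum: `∑' T = ∑_{i<I} T i + ∑' k, T (k + I)`
  have hsplit := (hsumm.sum_add_tsum_nat_add I).symm
  -- `∑' T - (-ℓ) ...`: we show `‖-∑' T - ℓ‖ < ε`
  rw [dist_eq_norm]
  -- the identity `-∑' T - ℓ = ∑_{1 ≤ i < I} w i (A(i+1) - ℓ) + ∑' k, w (I+k) (A(I+k+1) - ℓ)`
  have htail_summ : Summable fun k : ℕ => (w (I + k) : ℂ) * (A (I + k + 1) - ℓ) := by
    refine Summable.of_norm_bounded (g := fun k => E * w (I + k)) ((hwtail.summable).mul_left E) fun k => ?_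
    rw [norm_mul, norm_real, Real.norm_eq_abs, abs_of_nonneg (hw0 _ (by omega)), mul_comm]
    exact mul_le_mul_of_nonneg_right (hEi _) (hw0 _ (by omega))
  have hident : -∑' i, T i - ℓ = ∑ i ∈ Finset.Ico 1 I, (w i : ℂ) * (A (i + 1) - ℓ) +
      ∑' k, (w (I + k) : ℂ) * (A (I + k + 1) - ℓ) := by
    -- `∑' T = ∑_{i < I} T i + ∑' k, T (k + I)` and `T i = -w i A(i+1)`
    have h1 : ∑ i ∈ Finset.range I, T i = -∑ i ∈ Finset.Ico 1 I, (w i : ℂ) * A (i + 1) := by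
      rw [Finset.range_eq_Ico, ← Finset.sum_Ico_consecutive _ (Nat.zero_le 1) hI1,
        Finset.sum_Ico_succ_top (Nat.zero_le 0), Finset.Ico_self, Finset.sum_empty, zero_add, hT0,
        zero_add, ← Finset.sum_neg_distrib]
      exact Finset.sum_congr rfl fun i _ => by rw [hTw]; ring
    have h2 : ∑' k, T (k + I) = -∑' k, (w (I + k) : ℂ) * A (I + k + 1) := by
      rw [← tsum_neg]
      refine tsum_congr fun k => ?_
      rw [hTw, show k + I = I + k from add_comm _ _]
      ring
    -- `∑' k, w (I+k) A(I+k+1) = ∑' k, w(I+k) (A - ℓ) + ℓ I^{-u}`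
    have hwsum : HasSum (fun k : ℕ => (w (I + k) : ℂ)) ((I : ℝ) ^ (-u) : ℝ) :=
      (hasSum_ofReal.mpr hwtail)
    have h3 : ∑' k, (w (I + k) : ℂ) * A (I + k + 1) =
        ∑' k, (w (I + k) : ℂ) * (A (I + k + 1) - ℓ) + ℓ * (((I : ℝ) ^ (-u) : ℝ) : ℂ) := by
      rw [← hwsum.tsum_eq, ← tsum_mul_left, ← htail_summ.tsum_add (hwsum.summable.mul_left ℓ)]
      exact tsum_congr fun k => by ring
    -- `∑_{1 ≤ i < I} w i A(i+1) = ∑ w i (A - ℓ) + ℓ (1 - I^{-u})`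
    have h4 : ∑ i ∈ Finset.Ico 1 I, (w i : ℂ) * A (i + 1) =
        ∑ i ∈ Finset.Ico 1 I, (w i : ℂ) * (A (i + 1) - ℓ) + ℓ * ((1 - (I : ℝ) ^ (-u) : ℝ) : ℂ) := by
      rw [← hwI, ofReal_sum, Finset.mul_sum, ← Finset.sum_add_distrib]
      exact Finset.sum_congr rfl fun i _ => by ring
    rw [hsplit, h1, h2, h3, h4]
    push_cast
    ring
  rw [hident]
  -- estimate the two pieces
  have hfin : ‖∑ i ∈ Finset.Ico 1 I, (w i : ℂ) * (A (i + 1) - ℓ)‖ ≤ E * (1 - (I : ℝ) ^ (-u)) := by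
    refine (norm_sum_le _ _).trans ?_
    calc ∑ i ∈ Finset.Ico 1 I, ‖(w i : ℂ) * (A (i + 1) - ℓ)‖ ≤ ∑ i ∈ Finset.Ico 1 I, w i * E := by
          refine Finset.sum_le_sum fun i hi => ?_
          have hi1 : 1 ≤ i := (Finset.mem_Ico.mp hi).1
          rw [norm_mul, norm_real, Real.norm_eq_abs, abs_of_nonneg (hw0 i hi1)]
          exact mul_le_mul_of_nonneg_left (hEi i) (hw0 i hi1)
      _ = E * (1 - (I : ℝ) ^ (-u)) := by rw [← Finset.sum_mul, hwI, mul_comm]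
  have htail : ‖∑' k, (w (I + k) : ℂ) * (A (I + k + 1) - ℓ)‖ ≤ ε / 3 * (I : ℝ) ^ (-u) := by
    refine tsum_of_norm_bounded (hwtail.mul_left (ε / 3)) fun k => ?_
    rw [norm_mul, norm_real, Real.norm_eq_abs, abs_of_nonneg (hw0 _ (by omega)), mul_comm]
    exact mul_le_mul_of_nonneg_right (hIe _ (by omega)) (hw0 _ (by omega))
  have hIu : (I : ℝ) ^ (-u) ≤ 1 :=
    Real.rpow_le_one_of_one_le_of_nonpos (by exact_mod_cast hI1) (neg_nonpos.mpr hu0.le)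
  calc ‖∑ i ∈ Finset.Ico 1 I, (w i : ℂ) * (A (i + 1) - ℓ) + ∑' k, (w (I + k) : ℂ) * (A (I + k + 1) - ℓ)‖
      ≤ E * (1 - (I : ℝ) ^ (-u)) + ε / 3 * (I : ℝ) ^ (-u) := norm_add_le_of_le hfin htail
    _ ≤ E * (1 - (I : ℝ) ^ (-u)) + ε / 3 * 1 := by gcongr
    _ < ε / 3 + ε / 3 * 1 := by linarith
    _ < ε := by linarith

end PartialEuler

end Literature.NumberTheory.LFunctions

end
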